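import Summits.Ventures.GridStability.Lyapunov.StructurePreservingBlockEnergy
import Summits.Ventures.GridStability.Lyapunov.StructurePreservingPolytope
import HarnessLib

/-!
# Signed couplings III — the certificate data: frustrated triangles with their own coupling mass, the block
# cover, its region and level; re-summation of the potential over the cover

Venture GRIDFUSION, G2-SCALE cell; card «idea-3 (cycle 4) / signed-coupling-triangle-absorption»
(HOME/IDEAS-G2.md § l.675; crit-1 GRADE PASS · NEW-COMBINATION, STATUS 2026-08-28T20:54:27Z); the planner's scratch
proof `HOME/idea-3/c4/BlockRoaW.lean` (sha16 ce7574047d5005c1, 2 175 lines, farm rc 0 / 0 sorry / standard axioms,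
crit-1 g2 independent check STATUS l.10676) filed in content by the cell's Lean-lane seat gridfusion-sos-5 (g11), split
into tree modules `StructurePreservingBlock{Energy,Rows,Cover,Region,Roa,Level,Toys}`; namespace renamed from
`…Ideas.TriangleAbsorption.Roa` to `…Lyapunov.StructurePreserving.SignedBlock`. 0 kit, 0 facts.
THREE COLUMNS: theorems about the MODELLED lossless structure-preserving model MV-3 with SIGNED couplings (negative
branch reactances: three-winding-transformer star equivalents, series capacitors); nothing here is a certificate for
any benchmark and nothing here certifies a real grid.

WHAT THIS MODULE SAYS (card K1′ data + the one new bookkeeping identity, `BlockRoaW.lean` §B–§C).  A `Triangle` carries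
its three buses (apex, two legs), its box half-width `ρ`, four row constants `(m₁, m₂, q₁, q₂)` and the coupling MASS
it takes (`w₁, w₂` on the legs, `−γ` on the base).  A `BlockCover p δ₀` of SIGNED structure-preserving data is a
finite family of triangles with: distinct vertices, `w₁, w₂ > 0`, `γ ≥ 0`, FREE coupling
`bfree i j = b i j − Σ_k coef_k i j ≥ 0` on every pair (every negative pair is absorbed by bases; legs may be SHARED —
multi-transformer substations), windows `|aᵢ| + ρ ≤ π/2`, the endpoint rows of module II and STRICT harmonic rows.
Its certified `region` = Vu–Turitsyn slabs `|σᵢⱼ| < π` on pairs with free coupling ∩ leg boxes `|x₁|,|x₂| < ρ`;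
its level predicate `LevelBelowFaces c` = `c < bfree·vtGap` on free coupled pairs and `c < F_k` on blocks.  The
re-summation `Σ b·f = Σ bfree·f + 2Σ_k blockSum_k f` (symmetric `f`; coupling MASS, not pairs, is partitioned) gives
`W(δ, δ₀) = ½Σ bfree·U + Σ_k W_k`.

* `Triangle` (`Owns`, `face`, `x₁`, `x₂`, `coef`, `blockSum`, `energy`, `energy_eq_blockEnergy`);
* `BlockCover` (`bfree`, `exists_owns_of_bfree_eq_zero`, `region`, `regionLe`, `LevelBelowFaces`, `isOpen_region`,
  `isClosed_regionLe`);
* `sum_sum_ite_sym2`, `sum_sum_coef_mul`, `sum_sum_eq_free_add_blocks`, `freeT`, `potential_eq_free_add_blocks`.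
-/

noncomputable section

open Set Filter Topology Real Finset
open Summit.Ventures.GridStability.Models.StructurePreserving
open Summit.Ventures.GridStability.Models.StructurePreserving.Params
open Summit.Ventures.GridStability.Lyapunov.StructurePreserving
open Literature.MathematicalPhysics.PowerSystems.ClassicalModel.LosslessSystem (vtGap vtGap_le_of_abs_eq)
open Literature.MathematicalPhysics.PowerSystems (SinusoidalCoupling.sector_nonneg
  SinusoidalCoupling.sector_pos_of_abs_add_lt)

namespace Summit.Ventures.GridStability.Lyapunov.StructurePreserving.SignedBlock

/-! ## §B. The certificate data: frustrated triangles WITH LEG SHARES and a block cover (indexed by `Fin t`)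

K1′ (weighted legs): a triangle no longer reads its leg couplings off `p.b`; it carries its own coupling
MASS `w₁, w₂ > 0` on the two legs and `γ ≥ 0` on the base, and the cover only requires that what the
triangles leave of every pair coupling — the FREE coupling `bfree i j = b i j − Σ_k coef_k i j` — is `≥ 0`.
Triangles may therefore SHARE legs (several three-winding units on one HV/MV bus pair); edge-disjointness and
the `covers` field of K1 disappear (a negative pair not absorbed by the triangles would leave `bfree < 0`). -/

variable {n : ℕ}

/-- ONE BLOCK: a frustrated triangle (apex `T`, legs `P₁ P₂`), its box half-width `ρ`, its four row
constants, and the coupling mass it takes: `w₁` on `{P₁, T}`, `w₂` on `{P₂, T}`, `−γ` on the base `{P₁, P₂}`. -/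
structure Triangle (n : ℕ) where
  apex : Fin n
  leg₁ : Fin n
  leg₂ : Fin n
  ρ : ℝ
  m₁ : ℝ
  m₂ : ℝ
  q₁ : ℝ
  q₂ : ℝ
  w₁ : ℝ
  w₂ : ℝ
  γ : ℝ

namespace Triangle

/-- The unordered bus pairs a triangle owns (`{leg₁, apex}`, `{leg₂, apex}`, `{leg₁, leg₂}`); a predicate on ordered
pairs, symmetric by `Sym2`. Bookkeeping, not a named fact. [folklore] -/
def Owns (K : Triangle n) (i j : Fin n) : Prop :=
  s(i, j) = s(K.leg₁, K.apex) ∨ s(i, j) = s(K.leg₂, K.apex) ∨ s(i, j) = s(K.leg₁, K.leg₂)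

/-- Face value `F_K` = the smaller of the two box-face closed forms. -/
def face (K : Triangle n) (γ : ℝ) : ℝ :=
  min (K.ρ ^ 2 * (K.m₁ - γ * K.m₂ / (2 * K.m₂ - γ))) (K.ρ ^ 2 * (K.m₂ - γ * K.m₁ / (2 * K.m₁ - γ)))

/-- Leg deviations `x₁, x₂` of an angle vector `δ` from `δ₀`. -/
def x₁ (K : Triangle n) (δ₀ δ : Fin n → ℝ) : ℝ := (δ K.leg₁ - δ K.apex) - (δ₀ K.leg₁ - δ₀ K.apex)
/-- Second leg deviation `x₂` of an angle vector `δ` from `δ₀`. -/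
def x₂ (K : Triangle n) (δ₀ δ : Fin n → ℝ) : ℝ := (δ K.leg₂ - δ K.apex) - (δ₀ K.leg₂ - δ₀ K.apex)

/-- The coupling mass the triangle takes from the unordered pair `{i, j}`. -/
def coef (K : Triangle n) (i j : Fin n) : ℝ :=
  (if s(i, j) = s(K.leg₁, K.apex) then K.w₁ else 0) + (if s(i, j) = s(K.leg₂, K.apex) then K.w₂ else 0)
    + (if s(i, j) = s(K.leg₁, K.leg₂) then -K.γ else 0)

/-- The coupling mass taken from a pair does not depend on the orientation. [folklore] -/
theorem coef_symm (K : Triangle n) (i j : Fin n) : K.coef j i = K.coef i j := by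
  have h : s(j, i) = s(i, j) := Sym2.eq_swap
  simp only [coef, h]

/-- A pair from which the triangle takes nonzero mass is one of its three pairs. [folklore] -/
theorem owns_of_coef_ne_zero (K : Triangle n) {i j : Fin n} (h : K.coef i j ≠ 0) : K.Owns i j := by
  by_contra hno
  simp only [Owns, not_or] at hno
  apply h
  simp only [coef, hno.1, hno.2.1, hno.2.2, if_false, add_zero]

/-- The WEIGHTED sum of a pair family over the three pairs of the triangle (one orientation each). -/
def blockSum (K : Triangle n) (f : Fin n → Fin n → ℝ) : ℝ :=
  K.w₁ * f K.leg₁ K.apex + K.w₂ * f K.leg₂ K.apex + (-K.γ) * f K.leg₁ K.leg₂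

/-- Block branch energy `W_K(δ)` in the tree's coordinates (with the triangle's own coupling mass). -/
def energy (K : Triangle n) (δ₀ δ : Fin n → ℝ) : ℝ :=
  K.blockSum fun i j => branchEnergy (δ i - δ j) (δ₀ i - δ₀ j)

/-- The block energy in tree coordinates is the `blockEnergy` of module I in leg-deviation coordinates. [folklore] -/
theorem energy_eq_blockEnergy (K : Triangle n) (δ₀ δ : Fin n → ℝ) :
    K.energy δ₀ δ = blockEnergy K.w₁ K.w₂ K.γ
      (δ₀ K.leg₁ - δ₀ K.apex) (δ₀ K.leg₂ - δ₀ K.apex) (δ₀ K.leg₁ - δ₀ K.leg₂)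
      (K.x₁ δ₀ δ) (K.x₂ δ₀ δ) := by
  simp only [energy, blockSum, blockEnergy, U_eq_branchEnergy, x₁, x₂]
  have e1 : δ₀ K.leg₁ - δ₀ K.apex + (δ K.leg₁ - δ K.apex - (δ₀ K.leg₁ - δ₀ K.apex)) = δ K.leg₁ - δ K.apex := by ring
  have e2 : δ₀ K.leg₂ - δ₀ K.apex + (δ K.leg₂ - δ K.apex - (δ₀ K.leg₂ - δ₀ K.apex)) = δ K.leg₂ - δ K.apex := by ring
  have e3 : δ₀ K.leg₁ - δ₀ K.leg₂ + (δ K.leg₁ - δ K.apex - (δ₀ K.leg₁ - δ₀ K.apex)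
      - (δ K.leg₂ - δ K.apex - (δ₀ K.leg₂ - δ₀ K.apex))) = δ K.leg₁ - δ K.leg₂ := by ring
  rw [e1, e2, e3]
  ring

end Triangle

/-- **The certificate data (K1′)**: a block cover of SIGNED structure-preserving data `p` at `δ₀` — `t`
frustrated triangles with pairwise distinct vertices and their own coupling masses (`w₁, w₂ > 0`, `γ ≥ 0`),
the FREE coupling `b i j − Σ_k coef_k i j ≥ 0` on every pair (so every negative pair is absorbed by the
triangles' bases, and legs may be shared), positive legs inside the window `|aᵢ| + ρ ≤ π/2`, and the
closed-form ROWS stated with the triangle's own masses. -/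
structure BlockCover (p : Params n) (δ₀ : Fin n → ℝ) where
  t : ℕ
  tri : Fin t → Triangle n
  distinct : ∀ k, (tri k).apex ≠ (tri k).leg₁ ∧ (tri k).apex ≠ (tri k).leg₂ ∧ (tri k).leg₁ ≠ (tri k).leg₂
  legs_pos : ∀ k, 0 < (tri k).w₁ ∧ 0 < (tri k).w₂
  base_nonneg : ∀ k, 0 ≤ (tri k).γ
  free_nonneg : ∀ i j, 0 ≤ p.b i j - ∑ k, (tri k).coef i j
  ρ_pos : ∀ k, 0 < (tri k).ρ
  window : ∀ k, |δ₀ (tri k).leg₁ - δ₀ (tri k).apex| + (tri k).ρ ≤ π / 2 ∧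
    |δ₀ (tri k).leg₂ - δ₀ (tri k).apex| + (tri k).ρ ≤ π / 2
  row_m : ∀ k,
    ((tri k).m₁ * (tri k).ρ ^ 2 ≤ (tri k).w₁ * U (δ₀ (tri k).leg₁ - δ₀ (tri k).apex) (tri k).ρ ∧
     (tri k).m₁ * (tri k).ρ ^ 2 ≤ (tri k).w₁ * U (δ₀ (tri k).leg₁ - δ₀ (tri k).apex) (-(tri k).ρ)) ∧
    ((tri k).m₂ * (tri k).ρ ^ 2 ≤ (tri k).w₂ * U (δ₀ (tri k).leg₂ - δ₀ (tri k).apex) (tri k).ρ ∧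
     (tri k).m₂ * (tri k).ρ ^ 2 ≤ (tri k).w₂ * U (δ₀ (tri k).leg₂ - δ₀ (tri k).apex) (-(tri k).ρ))
  row_q : ∀ k,
    ((tri k).q₁ * (tri k).ρ ≤ (tri k).w₁ *
        (Real.sin (δ₀ (tri k).leg₁ - δ₀ (tri k).apex + (tri k).ρ) - Real.sin (δ₀ (tri k).leg₁ - δ₀ (tri k).apex)) ∧
     (tri k).q₁ * (tri k).ρ ≤ (tri k).w₁ *
        (Real.sin (δ₀ (tri k).leg₁ - δ₀ (tri k).apex) - Real.sin (δ₀ (tri k).leg₁ - δ₀ (tri k).apex - (tri k).ρ))) ∧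
    ((tri k).q₂ * (tri k).ρ ≤ (tri k).w₂ *
        (Real.sin (δ₀ (tri k).leg₂ - δ₀ (tri k).apex + (tri k).ρ) - Real.sin (δ₀ (tri k).leg₂ - δ₀ (tri k).apex)) ∧
     (tri k).q₂ * (tri k).ρ ≤ (tri k).w₂ *
        (Real.sin (δ₀ (tri k).leg₂ - δ₀ (tri k).apex) - Real.sin (δ₀ (tri k).leg₂ - δ₀ (tri k).apex - (tri k).ρ)))
  harmonic_m : ∀ k,
    (tri k).γ / 2 < (tri k).m₁ ∧ (tri k).γ / 2 < (tri k).m₂ ∧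
      (tri k).γ / 2 * ((tri k).m₁ + (tri k).m₂) < (tri k).m₁ * (tri k).m₂
  harmonic_q : ∀ k,
    (tri k).γ < (tri k).q₁ ∧ (tri k).γ < (tri k).q₂ ∧
      (tri k).γ * ((tri k).q₁ + (tri k).q₂) < (tri k).q₁ * (tri k).q₂

namespace BlockCover

variable {p : Params n} {δ₀ : Fin n → ℝ}

/-- The FREE coupling of a pair: what the triangles leave of `bᵢⱼ`. -/
def bfree (𝒦 : BlockCover p δ₀) (i j : Fin n) : ℝ := p.b i j - ∑ k, (𝒦.tri k).coef i j

/-- The free coupling is nonnegative (the cover's `free_nonneg` field). [folklore] -/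
theorem bfree_nonneg (𝒦 : BlockCover p δ₀) (i j : Fin n) : 0 ≤ 𝒦.bfree i j := 𝒦.free_nonneg i j

/-- The free coupling is symmetric when `b` is. [folklore] -/
theorem bfree_symm (𝒦 : BlockCover p δ₀) (hsymm : ∀ i j, p.b i j = p.b j i) (i j : Fin n) :
    𝒦.bfree j i = 𝒦.bfree i j := by
  unfold bfree
  rw [hsymm j i]
  congr 1
  exact Finset.sum_congr rfl fun k _ => (𝒦.tri k).coef_symm i j

/-- A coupled pair with no free coupling left is owned by some triangle. -/
theorem exists_owns_of_bfree_eq_zero (𝒦 : BlockCover p δ₀) {i j : Fin n} (hb : p.b i j ≠ 0)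
    (h : 𝒦.bfree i j = 0) : ∃ k, (𝒦.tri k).Owns i j := by
  have hs : ∑ k, (𝒦.tri k).coef i j ≠ 0 := by
    intro h0
    unfold bfree at h
    rw [h0, sub_zero] at h
    exact hb h
  obtain ⟨k, _, hk⟩ := Finset.exists_ne_zero_of_sum_ne_zero hs
  exact ⟨k, (𝒦.tri k).owns_of_coef_ne_zero hk⟩

/-- The OPEN certified region: Vu–Turitsyn slabs on the pairs with free coupling, boxes on the legs. -/
def region (𝒦 : BlockCover p δ₀) : Set ((Fin n → ℝ) × (Fin n → ℝ)) :=
  {x | ∀ i j, 𝒦.bfree i j ≠ 0 → |(x.1 i - x.1 j) + (δ₀ i - δ₀ j)| < π} ∩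
    {x | ∀ k, |(𝒦.tri k).x₁ δ₀ x.1| < (𝒦.tri k).ρ ∧ |(𝒦.tri k).x₂ δ₀ x.1| < (𝒦.tri k).ρ}

/-- Its closure-shaped companion (non-strict inequalities). -/
def regionLe (𝒦 : BlockCover p δ₀) : Set ((Fin n → ℝ) × (Fin n → ℝ)) :=
  {x | ∀ i j, 𝒦.bfree i j ≠ 0 → |(x.1 i - x.1 j) + (δ₀ i - δ₀ j)| ≤ π} ∩
    {x | ∀ k, |(𝒦.tri k).x₁ δ₀ x.1| ≤ (𝒦.tri k).ρ ∧ |(𝒦.tri k).x₂ δ₀ x.1| ≤ (𝒦.tri k).ρ}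

/-- The open region lies in its closed companion. [folklore] -/
theorem region_subset_regionLe (𝒦 : BlockCover p δ₀) : 𝒦.region ⊆ 𝒦.regionLe := fun _ hx =>
  ⟨fun i j hij => (hx.1 i j hij).le, fun k => ⟨(hx.2 k).1.le, (hx.2 k).2.le⟩⟩

/-- The LEVEL HYPOTHESIS of the block certificate: `c` is below every free-coupling face `bfreeᵢⱼ·vtGap(δ₀ᵢ − δ₀ⱼ)`
(the tree's polytope-route level on the pairs with free coupling) and below every block face `F_k`.  A hypothesis of
data discharged per instance by rational checks (module `…BlockLevel`), not a named fact.  MODELLED (MV-3).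
[cite: VuTuritsyn2016, Appendix 9.3] (the per-edge level `V_min`; block faces are this cell's card K2) -/
structure LevelBelowFaces (𝒦 : BlockCover p δ₀) (c : ℝ) : Prop where
  /-- `c` is below every free-coupling face `bfreeᵢⱼ·vtGap(δ₀ᵢ − δ₀ⱼ)`. -/
  free : ∀ i j, 𝒦.bfree i j ≠ 0 → c < 𝒦.bfree i j * vtGap (δ₀ i - δ₀ j)
  /-- `c` is below every block face `F_k`. -/
  block : ∀ k, c < (𝒦.tri k).face (𝒦.tri k).γ

/-- The certified region is open (finitely many strict continuous inequalities). [folklore] -/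
theorem isOpen_region (𝒦 : BlockCover p δ₀) : IsOpen 𝒦.region := by
  refine IsOpen.inter ?_ ?_
  · simp only [setOf_forall]
    refine isOpen_iInter_of_finite fun i => isOpen_iInter_of_finite fun j =>
      isOpen_iInter_of_finite fun _ => ?_
    exact isOpen_lt (by fun_prop) continuous_const
  · simp only [setOf_forall, Triangle.x₁, Triangle.x₂]
    refine isOpen_iInter_of_finite fun k => ?_
    simp only [setOf_and]
    exact (isOpen_lt (by fun_prop) continuous_const).inter (isOpen_lt (by fun_prop) continuous_const)


/-- The closed companion of the region is closed. [folklore] -/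
theorem isClosed_regionLe (𝒦 : BlockCover p δ₀) : IsClosed 𝒦.regionLe := by
  refine IsClosed.inter ?_ ?_
  · simp only [setOf_forall]
    refine isClosed_iInter fun i => isClosed_iInter fun j => isClosed_iInter fun _ => ?_
    exact isClosed_le (by fun_prop) continuous_const
  · simp only [setOf_forall, Triangle.x₁, Triangle.x₂]
    refine isClosed_iInter fun k => ?_
    simp only [setOf_and]
    exact (isClosed_le (by fun_prop) continuous_const).inter (isClosed_le (by fun_prop) continuous_const)

/-! ## §C. Re-summation of a symmetric pair family over the cover (coupling MASS, not pairs, is partitioned) -/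

/-- One unordered pair `{u, v}` (`u ≠ v`) seen in the ordered double sum. -/
theorem sum_sum_ite_sym2 (f : Fin n → Fin n → ℝ) {u v : Fin n} (huv : u ≠ v) :
    ∑ i, ∑ j, (if s(i, j) = s(u, v) then f i j else 0) = f u v + f v u := by
  classical
  have key : ∀ i j, (if s(i, j) = s(u, v) then f i j else 0)
      = (if i = u ∧ j = v then f i j else 0) + (if i = v ∧ j = u then f i j else 0) := by
    intro i j
    by_cases h1 : i = u ∧ j = v
    · obtain ⟨rfl, rfl⟩ := h1
      have h2 : ¬ (i = j ∧ j = i) := fun h => huv h.1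
      simp [h2]
    · by_cases h2 : i = v ∧ j = u
      · obtain ⟨rfl, rfl⟩ := h2
        simp [h1, Sym2.eq_swap]
      · have h3 : ¬ s(i, j) = s(u, v) := by
          rw [Sym2.eq_iff]; push Not
          exact ⟨fun h => (h1 ⟨h, ·⟩) , fun h => (h2 ⟨h, ·⟩)⟩
        simp [h1, h2, h3]
  simp_rw [key, Finset.sum_add_distrib]
  have hA : ∑ i, ∑ j, (if i = u ∧ j = v then f i j else 0) = f u v := by
    rw [Finset.sum_eq_single u, Finset.sum_eq_single v]
    · simp
    · intro j _ hj; simp [hj]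
    · simp
    · intro i _ hi; exact Finset.sum_eq_zero fun j _ => by simp [hi]
    · simp
  have hB : ∑ i, ∑ j, (if i = v ∧ j = u then f i j else 0) = f v u := by
    rw [Finset.sum_eq_single v, Finset.sum_eq_single u]
    · simp
    · intro j _ hj; simp [hj]
    · simp
    · intro i _ hi; exact Finset.sum_eq_zero fun j _ => by simp [hi]
    · simp
  rw [hA, hB]

/-- The ordered double sum of `coef · f` over ALL pairs is twice the triangle's weighted block sum. -/
theorem sum_sum_coef_mul (K : Triangle n) (hK : K.apex ≠ K.leg₁ ∧ K.apex ≠ K.leg₂ ∧ K.leg₁ ≠ K.leg₂)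
    (f : Fin n → Fin n → ℝ) (hf : ∀ i j, f j i = f i j) :
    ∑ i, ∑ j, K.coef i j * f i j = 2 * K.blockSum f := by
  classical
  obtain ⟨h1, h2, h3⟩ := hK
  have key : ∀ i j, K.coef i j * f i j
      = (if s(i, j) = s(K.leg₁, K.apex) then K.w₁ * f i j else 0)
        + (if s(i, j) = s(K.leg₂, K.apex) then K.w₂ * f i j else 0)
        + (if s(i, j) = s(K.leg₁, K.leg₂) then (-K.γ) * f i j else 0) := by
    intro i j
    simp only [Triangle.coef]
    split_ifs <;> ring
  simp_rw [key, Finset.sum_add_distrib]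
  rw [sum_sum_ite_sym2 (fun i j => K.w₁ * f i j) (Ne.symm h1),
    sum_sum_ite_sym2 (fun i j => K.w₂ * f i j) (Ne.symm h2),
    sum_sum_ite_sym2 (fun i j => (-K.γ) * f i j) h3]
  simp only [Triangle.blockSum, hf K.leg₁ K.apex, hf K.leg₂ K.apex, hf K.leg₁ K.leg₂]
  ring

/-- **Re-summation over the cover**: `Σ b·f = Σ bfree·f + 2 Σ_k (weighted block sums)` for a symmetric
pair family — the coupling MASS is partitioned, pairs need not be. -/
theorem sum_sum_eq_free_add_blocks (𝒦 : BlockCover p δ₀) (f : Fin n → Fin n → ℝ)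
    (hf : ∀ i j, f j i = f i j) :
    ∑ i, ∑ j, p.b i j * f i j = ∑ i, ∑ j, 𝒦.bfree i j * f i j
      + 2 * ∑ k, (𝒦.tri k).blockSum f := by
  classical
  have key : ∀ i j, p.b i j * f i j = 𝒦.bfree i j * f i j + ∑ k, (𝒦.tri k).coef i j * f i j := by
    intro i j
    rw [bfree, sub_mul, Finset.sum_mul]
    ring
  have hsplit : ∑ i, ∑ j, p.b i j * f i j = ∑ i, ∑ j, 𝒦.bfree i j * f i j
      + ∑ i, ∑ j, ∑ k, (𝒦.tri k).coef i j * f i j := by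
    rw [← Finset.sum_add_distrib]
    refine Finset.sum_congr rfl fun i _ => ?_
    rw [← Finset.sum_add_distrib]
    exact Finset.sum_congr rfl fun j _ => key i j
  rw [hsplit]
  congr 1
  rw [Finset.mul_sum]
  have hcomm : ∑ i, ∑ j, ∑ k, (𝒦.tri k).coef i j * f i j
      = ∑ k, ∑ i, ∑ j, (𝒦.tri k).coef i j * f i j := by
    have hin : ∀ i, ∑ j, ∑ k, (𝒦.tri k).coef i j * f i j
        = ∑ k, ∑ j, (𝒦.tri k).coef i j * f i j := fun i => Finset.sum_comm
    simp_rw [hin]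
    exact Finset.sum_comm
  rw [hcomm]
  exact Finset.sum_congr rfl fun k _ => sum_sum_coef_mul (𝒦.tri k) (𝒦.distinct k) f hf

/-- The FREE edge-energy family `bfreeᵢⱼ·U(σᵢⱼ, σ*ᵢⱼ)`. -/
def freeT (𝒦 : BlockCover p δ₀) (δ : Fin n → ℝ) (i j : Fin n) : ℝ :=
  𝒦.bfree i j * branchEnergy (δ i - δ j) (δ₀ i - δ₀ j)

/-- **The potential splits over the cover**: `W(δ, δ₀) = ½ Σ bfreeᵢⱼ U + Σ_k W_k`. -/
theorem potential_eq_free_add_blocks (𝒦 : BlockCover p δ₀) (δ : Fin n → ℝ) :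
    p.potential δ₀ δ = 1 / 2 * ∑ i, ∑ j, 𝒦.freeT δ i j + ∑ k, (𝒦.tri k).energy δ₀ δ := by
  have hT : ∀ i j, branchEnergy (δ j - δ i) (δ₀ j - δ₀ i)
      = branchEnergy (δ i - δ j) (δ₀ i - δ₀ j) := fun i j => by
    rw [show δ j - δ i = -(δ i - δ j) by ring,
      show δ₀ j - δ₀ i = -(δ₀ i - δ₀ j) by ring, branchEnergy_neg_neg]
  have hpot : p.potential δ₀ δ
      = 1 / 2 * ∑ i, ∑ j, p.b i j * branchEnergy (δ i - δ j) (δ₀ i - δ₀ j) := rfl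
  rw [hpot, 𝒦.sum_sum_eq_free_add_blocks _ hT]
  simp only [Triangle.energy, freeT]
  ring

end BlockCover

end Summit.Ventures.GridStability.Lyapunov.StructurePreserving.SignedBlock

end
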